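import Summits.QuantumFields.BalabanUV.T4Continuum.Spine.NE1p.DressedSmallFieldSeries

/-!
# T⁴ programme, spine estimate NE1′ (node O3b/H2) — WITNESS W28 «THE POLYMER SERIES CONVERGES»: the owner's N0i series face
# (`DressedSmallFieldSeries`, p219191: (E1) termwise analyticity, (E2) a PARAMETER-FREE termwise majorant, (E3) `HasSum u M`) FIRES on a
# GENUINELY INFINITE analytic family — all four ENDs ONCE BY NAME, their constants SHARP on the datum, (E3) LOAD-BEARING in kernel

Cell `pub-balaban`, sub-cell `t4`, row NE1′ formalisation crew (`t4/formal/NE1p/LEAVES.md` row W28; INTENT journal l.15700), unit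
`b2b-balaban-t4-ne1p-formalise-leaf-03` (gen 9).  ADDITIVE — imports N0i `Spine/NE1p/DressedSmallFieldSeries` ONLY; two toy DATA `def`s
(`expFam`, `expMaj`) + theorems + one `example`; 0 `def … : Prop`, 0 cite, 0 sorry; nothing of N0i ∕ N0g restated.

WHY.  N0i types the PAY-side SERIES form of the small-field allowance (output `Σ' H i`; Weierstrass ∕ Cauchy over SHAPES).  Every landed or
booked small-field toy of the crew (W23–W27, S24, S25) is a FINITE polymer family through N0j's `locE` Finset sums: the binder group
{infinite index, (E3), `∑'`} had NO inhabitant and N0i's four ENDs NO consumer.  Here ONE decided datum fires all four, with certificates.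
§1 DATUM `expFam b n μ := (b·μ)^n / n!` (index `n : ℕ`, values in `ℂ`, strength `b ≥ 0`), majorant `expMaj b μ₁ n := (b·μ₁)^n / n!`
on `|μ| < μ₁`; `hE1` (entire), `hE2`, `hE3 : HasSum (expMaj b μ₁) (exp (b·μ₁))` (Mathlib's `NormedSpace.expSeries_div_hasSum_exp`
BY NAME); closed form `tsum_expFam : Σ' n, expFam b n μ = cexp (b·μ)`.  §2 THE FOUR N0i ENDs ONCE EACH BY NAME: `seriesFace_fires`
(analytic ∧ `‖Σ'‖ ≤ e^{bμ₁}`), `muPart_fires` (`≤ 2e^{bμ₁}μ₀/μ₁` on `|μ| ≤ μ₀ < μ₁`; closed form `muPart_fires'`), `linearResponse_fires`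
(the output's derivative IS the convergent sum of the termwise derivatives ∧ `≤ 2e^{bμ₁}/(μ₁ − μ₀)`), `regen_fires` (radius `ε/σ`;
closed form `regen_fires'`: `‖cexp b − 1‖ ≤ 2e^{bε/σ}/ε·σ`).  §3 GENUINE AND SHARP: `expFam_ne_zero` (EVERY term ≠ 0),
`deriv_expFam_zero` ∕ `deriv_expFam_succ` ∕ `deriv_output` ∕ `respSeries_hasSum` (the response series is `b·` the SAME series shifted —
genuinely infinite — and sums to `b·cexp(bμ)`), `muPart_live` (the bounded μ-part is `≠ 0` at every real source `t > 0`),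
`expMaj_eq_norm` ((E2) has ZERO slack termwise:
the majorant IS the term's norm at `μ₁`), `norm_output_real` + `outputBound_sharp` (`M = Σ u = e^{bμ₁}` is the SUP of the output on the
disc: §1's constant cannot be improved here).  §4 (E3) IS LOAD-BEARING (a theorem, not only a mutant): `μ ↦ μ^n` on `ball 0 1` meets (E1)
(`geom_E1`) and (E2) (`geom_E2`); EVERY parameter-free majorant it admits has `1 ≤ u n` (`one_le_of_majorant`), so NONE is summable
(`not_summable_of_majorant`), and §1's conclusion FAILS: `not_bounded_geom` (output `(1 − s)⁻¹`, Mathlib's `hasSum_geometric_of_norm_lt_one`).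
§5 one `example` (one currency).  Planted mutants (NOT filed; `HOME/t4/b2b-balaban-t4-ne1p-formalise-leaf-03/g9/W28_M{1,2,3}.NOT-TO-FILE
.lean`, rc 1 each): M1 `hE2` with majorant `(bμ₁)^n/(n+1)!`; M2 `muPart_fires` without the factor `2`; M3 `not_bounded_geom` on `ball 0 (1/2)`.

HONEST FRAMING.  A ONE-activity exponential TOY: `n` is print's OUTER index of [Balaban1988RGII] (2.12)–(2.13) (number of activities in a
cluster), NOT a polymer; the ρ^T ∕ tree-graph combinatorics and (2.40)'s summation «by [26]» are NOT modelled — (E3) is supplied by the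
exponential series itself, which (2.15)'s «exp[Σ|τ(Y)||V_k(Y,B)|]» majorant TYPE merely resembles.  The identification of (E1)–(E3) with
Bałaban's μ-extended dressed activities is the owner's READING (t4-ref2 C-t4r2-340 (n1)∕(n3)), instantiated NOWHERE; no locus quoted as a
fact; ABSOLUTE RULE honoured.  Certified: N0i's four ENDs are jointly inhabited by a genuinely infinite analytic family with a parameter-free
summable majorant, their constants are sharp ON THIS DATUM, and (E3) cannot be dropped from OUR module N0i §1 (a statement about its
SHAPE, not about Bałaban's series); discharges no wall item; R-t4r2-Q2 NOT met thereby.  NE1′ NOT printed, NOT proved; spine PROVED 0∕9;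
count 9 unchanged; wall wording v1.6 of record untouched.  Rung (B)+1 on ONE finite four-torus — NOT infinite volume, NOT a mass gap, NOT
OS on ℝ⁴, NOT Clay.  HONEST DEPENDENCY: continuum YM on T⁴ ⇐ BetaPertH ∧ nine spine estimates (0/9 proved); BetaPertH ⇐ (D1) ∧ (D4) ∧
CAP+tail; G-an2-4 gates asym, D1 and NE2/3/4. -/

noncomputable section

namespace Summit.QuantumFields.BalabanUV.T4Continuum.NE1p.DressedSmallFieldSeriesWitness

open Metric Set Complex Filter Topology
open scoped Nat
open Summit.QuantumFields.BalabanUV.T4Continuum.NE1p.DressedSmallFieldSeries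

/-! ## §1 THE DATUM: the exponential series of strength `b` in the source, its parameter-free majorant, (E1)–(E3), closed form -/

/-- Toy DATA: the `n`-th term of the exponential series of strength `b` in the complex source `μ`, `(b·μ)^n / n!`. -/
def expFam (b : ℝ) (n : ℕ) (μ : ℂ) : ℂ := ((b : ℂ) * μ) ^ n / n !

/-- Toy DATA: the parameter-free majorant of `expFam b n` on the disc `|μ| < μ₁`, `(b·μ₁)^n / n!`. -/
def expMaj (b μ₁ : ℝ) (n : ℕ) : ℝ := (b * μ₁) ^ n / n !

variable {b μ₁ μ₀ ε σ : ℝ} {μ : ℂ}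

/-- A real point `0 ≤ t < R` lies in the complex disc `ball 0 R`. [arith] -/
theorem real_mem_ball {t R : ℝ} (ht0 : 0 ≤ t) (htR : t < R) : (t : ℂ) ∈ ball (0 : ℂ) R := by
  rw [mem_ball, dist_zero_right, Complex.norm_real, Real.norm_of_nonneg ht0]; exact htR

/-- The norm of a term: `‖expFam b n μ‖ = (b·‖μ‖)^n / n!` for `b ≥ 0`. [arith] -/
theorem norm_expFam (hb : 0 ≤ b) (n : ℕ) (μ : ℂ) : ‖expFam b n μ‖ = (b * ‖μ‖) ^ n / n ! := by
  rw [expFam, norm_div, norm_pow, norm_mul, Complex.norm_real, Real.norm_of_nonneg hb, Complex.norm_natCast]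

/-- **(E1)** on the datum: every term is entire, hence analytic on every disc. [folklore] -/
theorem hE1 (b : ℝ) (c : ℂ) (R : ℝ) (n : ℕ) : DifferentiableOn ℂ (expFam b n) (ball c R) :=
  (((differentiable_id.const_mul (b : ℂ)).pow n).div_const (n ! : ℂ)).differentiableOn

/-- **(E2)** on the datum: on the disc `|μ| < μ₁` the `n`-th term is bounded by the PARAMETER-FREE majorant `(b·μ₁)^n / n!`. [arith] -/
theorem hE2 (hb : 0 ≤ b) (n : ℕ) : ∀ s ∈ ball (0 : ℂ) μ₁, ‖expFam b n s‖ ≤ expMaj b μ₁ n := by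
  intro s hs
  rw [mem_ball, dist_zero_right] at hs; rw [norm_expFam hb, expMaj]
  exact div_le_div_of_nonneg_right
    (pow_le_pow_left₀ (mul_nonneg hb (norm_nonneg _)) (mul_le_mul_of_nonneg_left hs.le hb) n) (by positivity)

/-- **(E3)** on the datum: `HasSum (expMaj b μ₁) (e^{b·μ₁})` — Mathlib's `NormedSpace.expSeries_div_hasSum_exp` BY NAME. [folklore] -/
theorem hE3 (b μ₁ : ℝ) : HasSum (expMaj b μ₁) (Real.exp (b * μ₁)) := by
  have h := NormedSpace.expSeries_div_hasSum_exp (b * μ₁)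
  rwa [← Real.exp_eq_exp_ℝ] at h

/-- The series itself, in `HasSum` form: `Σ n, (b·μ)^n / n! = cexp (b·μ)`. [folklore] -/
theorem hasSum_expFam (b : ℝ) (μ : ℂ) : HasSum (fun n => expFam b n μ) (cexp ((b : ℂ) * μ)) := by
  have h := NormedSpace.expSeries_div_hasSum_exp ((b : ℂ) * μ)
  rwa [← Complex.exp_eq_exp_ℂ] at h

/-- CLOSED FORM of the output: `Σ' n, expFam b n μ = cexp (b·μ)`. [folklore] -/
theorem tsum_expFam (b : ℝ) (μ : ℂ) : ∑' n, expFam b n μ = cexp ((b : ℂ) * μ) := (hasSum_expFam b μ).tsum_eq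

/-! ## §2 THE FOUR N0i ENDs FIRE ON THE DATUM — once each, BY NAME -/

/-- **N0i §1 FIRES** (`series_analytic_bounded` BY NAME): the output is analytic on `|s| < μ₁` and bounded there by `M = e^{b·μ₁}`. -/
theorem seriesFace_fires (hb : 0 ≤ b) :
    DifferentiableOn ℂ (fun s => ∑' n, expFam b n s) (ball 0 μ₁) ∧
      ∀ s ∈ ball (0 : ℂ) μ₁, ‖∑' n, expFam b n s‖ ≤ Real.exp (b * μ₁) :=
  series_analytic_bounded (hE3 b μ₁) (fun n => hE1 b 0 μ₁ n) (hE2 hb)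

/-- **N0i §2 (μ-PART) FIRES** (`muPart_norm_le_of_termwise` BY NAME): on `|μ| ≤ μ₀ < μ₁` the μ-part is `≤ 2·e^{bμ₁}·μ₀/μ₁`. -/
theorem muPart_fires (hb : 0 ≤ b) (h01 : μ₀ < μ₁) (hμ : ‖μ‖ ≤ μ₀) :
    ‖(∑' n, expFam b n μ) - ∑' n, expFam b n 0‖ ≤ 2 * Real.exp (b * μ₁) * μ₀ / μ₁ :=
  muPart_norm_le_of_termwise (hE3 b μ₁) (Real.exp_pos _).le (fun n => hE1 b 0 μ₁ n) (hE2 hb) h01 hμ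

/-- The same in CLOSED FORM: `‖cexp(b·μ) − 1‖ ≤ 2·e^{bμ₁}·μ₀/μ₁` on the sub-window. [arith] -/
theorem muPart_fires' (hb : 0 ≤ b) (h01 : μ₀ < μ₁) (hμ : ‖μ‖ ≤ μ₀) :
    ‖cexp ((b : ℂ) * μ) - 1‖ ≤ 2 * Real.exp (b * μ₁) * μ₀ / μ₁ := by
  have h := muPart_fires hb h01 hμ
  rwa [tsum_expFam, tsum_expFam, mul_zero, Complex.exp_zero] at h

/-- **N0i §3 (LINEAR RESPONSE) FIRES** (`linearResponse_termwise` BY NAME): on the sub-window the derivative of the output in the source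
EXISTS as the convergent sum of the termwise derivatives and is `≤ 2·e^{bμ₁}/(μ₁ − μ₀)`. -/
theorem linearResponse_fires (hb : 0 ≤ b) (h01 : μ₀ < μ₁) (hμ : ‖μ‖ ≤ μ₀) :
    HasSum (fun n => deriv (expFam b n) μ) (deriv (fun s => ∑' n, expFam b n s) μ) ∧
      ‖deriv (fun s => ∑' n, expFam b n s) μ‖ ≤ 2 * Real.exp (b * μ₁) / (μ₁ - μ₀) :=
  linearResponse_termwise (hE3 b μ₁) (fun n => hE1 b 0 μ₁ n) (hE2 hb) h01 hμ

/-- **N0i §2 (REGENERATION) FIRES** (`regen_le_of_termwise` BY NAME) at the radius `ε/σ`: `‖Σ'(1) − Σ'(0)‖ ≤ (2·e^{b·ε/σ}/ε)·σ`. -/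
theorem regen_fires (hb : 0 ≤ b) (hσ : 0 < σ) (hσε : σ < ε) :
    ‖(∑' n, expFam b n 1) - ∑' n, expFam b n 0‖ ≤ 2 * Real.exp (b * (ε / σ)) / ε * σ :=
  regen_le_of_termwise hσ hσε (hE3 b (ε / σ)) (fun n => hE1 b 0 (ε / σ) n) (hE2 hb)

/-- The same in CLOSED FORM: `‖cexp b − 1‖ ≤ (2·e^{b·ε/σ}/ε)·σ`. [arith] -/
theorem regen_fires' (hb : 0 ≤ b) (hσ : 0 < σ) (hσε : σ < ε) :
    ‖cexp (b : ℂ) - 1‖ ≤ 2 * Real.exp (b * (ε / σ)) / ε * σ := by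
  have h := regen_fires hb hσ hσε
  rwa [tsum_expFam, tsum_expFam, mul_one, mul_zero, Complex.exp_zero] at h

/-! ## §3 GENUINE AND SHARP -/

/-- GENUINELY INFINITE: for `b ≠ 0` and `μ ≠ 0` EVERY term of the family is non-zero (no finite family in disguise). [arith] -/
theorem expFam_ne_zero (hb : b ≠ 0) (hμ : μ ≠ 0) (n : ℕ) : expFam b n μ ≠ 0 :=
  div_ne_zero (pow_ne_zero _ (mul_ne_zero (Complex.ofReal_ne_zero.mpr hb) hμ))
    (by exact_mod_cast Nat.factorial_ne_zero n)

/-- The zeroth term is the constant `1`: its source-derivative vanishes. [arith] -/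
theorem deriv_expFam_zero (b : ℝ) (μ : ℂ) : deriv (expFam b 0) μ = 0 := by
  rw [show expFam b 0 = fun _ => (1 : ℂ) from funext fun s => by simp [expFam], deriv_const]

/-- THE RESPONSE SERIES IS THE SHIFTED SERIES: `d/dμ expFam b (n+1) = b · expFam b n` (genuinely infinite). [folklore] -/
theorem deriv_expFam_succ (b : ℝ) (n : ℕ) (μ : ℂ) : deriv (expFam b (n + 1)) μ = (b : ℂ) * expFam b n μ := by
  have h : HasDerivAt (expFam b (n + 1))
      (((n + 1 : ℕ) : ℂ) * ((b : ℂ) * μ) ^ (n + 1 - 1) * ((b : ℂ) * 1) / ((n + 1) ! : ℂ)) μ :=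
    (((hasDerivAt_id' μ).const_mul (b : ℂ)).pow (n + 1)).div_const ((n + 1) ! : ℂ)
  rw [h.deriv, expFam, Nat.add_sub_cancel, Nat.factorial_succ, Nat.cast_mul]
  have h1 : ((n ! : ℕ) : ℂ) ≠ 0 := by exact_mod_cast Nat.factorial_ne_zero n
  have h2 : ((n + 1 : ℕ) : ℂ) ≠ 0 := by exact_mod_cast Nat.succ_ne_zero n
  field_simp

/-- The output's derivative in closed form: `d/dμ Σ' n, expFam b n μ = b · cexp (b·μ)`. [folklore] -/
theorem deriv_output (b : ℝ) (μ : ℂ) : deriv (fun s => ∑' n, expFam b n s) μ = (b : ℂ) * cexp ((b : ℂ) * μ) := by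
  have h1 : HasDerivAt (fun s : ℂ => (b : ℂ) * s) ((b : ℂ) * 1) μ := (hasDerivAt_id' μ).const_mul (b : ℂ)
  rw [show (fun s => ∑' n, expFam b n s) = fun s => cexp ((b : ℂ) * s) from funext (tsum_expFam b), h1.cexp.deriv,
    mul_one, mul_comm]

/-- THE RESPONSE SERIES SUMS TO `b·cexp(b·μ)` on the sub-window — N0i §3's first conjunct read through `deriv_output`. [folklore] -/
theorem respSeries_hasSum (hb : 0 ≤ b) (h01 : μ₀ < μ₁) (hμ : ‖μ‖ ≤ μ₀) :
    HasSum (fun n => deriv (expFam b n) μ) ((b : ℂ) * cexp ((b : ℂ) * μ)) :=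
  deriv_output b μ ▸ (linearResponse_fires hb h01 hμ).1

/-- THE μ-PART IS LIVE: at every real source `0 < t` with `0 < b` the quantity bounded by `muPart_fires` is `≠ 0`. [arith] -/
theorem muPart_live (hb : 0 < b) {t : ℝ} (ht : 0 < t) : (∑' n, expFam b n (t : ℂ)) - ∑' n, expFam b n 0 ≠ 0 := by
  rw [tsum_expFam, tsum_expFam, mul_zero, Complex.exp_zero, ← Complex.ofReal_mul, ← Complex.ofReal_exp,
    ← Complex.ofReal_one, ← Complex.ofReal_sub, Complex.ofReal_ne_zero, sub_ne_zero, Ne, Real.exp_eq_one_iff]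
  exact (mul_pos hb ht).ne'

/-- (E2) HAS ZERO SLACK TERMWISE: the parameter-free majorant IS the norm of the term at the boundary point `μ₁ ≥ 0`. [arith] -/
theorem expMaj_eq_norm (hb : 0 ≤ b) (hμ₁ : 0 ≤ μ₁) (n : ℕ) : expMaj b μ₁ n = ‖expFam b n (μ₁ : ℂ)‖ := by
  rw [norm_expFam hb, Complex.norm_real, Real.norm_of_nonneg hμ₁, expMaj]

/-- On the real axis the output's norm is `e^{b·t}`. [arith] -/
theorem norm_output_real (b t : ℝ) : ‖∑' n, expFam b n (t : ℂ)‖ = Real.exp (b * t) := by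
  rw [tsum_expFam, ← Complex.ofReal_mul, Complex.norm_exp, Complex.ofReal_re]

/-- **THE OUTPUT BOUND IS SHARP ON THIS DATUM**: `M = Σ u = e^{b·μ₁}` is the SUP of the output's norm over the disc (every `δ > 0` is
beaten inside the disc) — N0i §1's constant cannot be improved here. [folklore] -/
theorem outputBound_sharp (hμ₁ : 0 < μ₁) {δ : ℝ} (hδ : 0 < δ) :
    ∃ s ∈ ball (0 : ℂ) μ₁, Real.exp (b * μ₁) - δ < ‖∑' n, expFam b n s‖ := by
  have hcont : ContinuousAt (fun t : ℝ => Real.exp (b * t)) μ₁ :=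
    (Real.continuous_exp.comp (continuous_const.mul continuous_id)).continuousAt
  obtain ⟨η, hη, hclose⟩ := Metric.continuousAt_iff.1 hcont δ hδ
  have hm0 : 0 < min η μ₁ := lt_min hη hμ₁
  obtain ⟨hmη, hmμ⟩ : min η μ₁ ≤ η ∧ min η μ₁ ≤ μ₁ := ⟨min_le_left _ _, min_le_right _ _⟩
  refine ⟨((μ₁ - min η μ₁ / 2 : ℝ) : ℂ), real_mem_ball (by linarith) (by linarith), ?_⟩
  have hd : dist (μ₁ - min η μ₁ / 2) μ₁ < η := by
    rw [Real.dist_eq, show μ₁ - min η μ₁ / 2 - μ₁ = -(min η μ₁ / 2) by ring, abs_neg, abs_of_pos (by linarith)]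
    linarith
  have h := (abs_lt.1 (Real.dist_eq _ _ ▸ hclose hd)).1
  rw [norm_output_real]
  linarith

/-! ## §4 (E3) IS LOAD-BEARING for OUR module's SHAPE: `μ ↦ μ^n` meets (E1), (E2), has no summable majorant, fails §1's conclusion -/

/-- (E1) for the geometric family `μ ↦ μ^n`. [folklore] -/
theorem geom_E1 (n : ℕ) : DifferentiableOn ℂ (fun μ : ℂ => μ ^ n) (ball 0 1) := (differentiable_id.pow n).differentiableOn

/-- (E2) for the geometric family with the parameter-free majorant `1`. [arith] -/
theorem geom_E2 (n : ℕ) : ∀ s ∈ ball (0 : ℂ) 1, ‖s ^ n‖ ≤ 1 := fun s hs => by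
  rw [mem_ball, dist_zero_right] at hs
  exact norm_pow s n ▸ pow_le_one₀ (norm_nonneg _) hs.le

/-- EVERY parameter-free majorant of the geometric family on the open unit disc is `≥ 1` termwise (sup of `|μ^n|` = 1). [folklore] -/
theorem one_le_of_majorant {u : ℕ → ℝ} (hu : ∀ n, ∀ s ∈ ball (0 : ℂ) 1, ‖s ^ n‖ ≤ u n) (n : ℕ) : 1 ≤ u n := by
  have ht : Tendsto (fun r : ℝ => r ^ n) (𝓝[<] (1 : ℝ)) (𝓝 1) := by
    simpa using ((continuous_pow n).tendsto (1 : ℝ)).mono_left (nhdsWithin_le_nhds (s := Iio (1 : ℝ)))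
  refine le_of_tendsto ht ?_
  filter_upwards [mem_nhdsWithin_of_mem_nhds (Ioi_mem_nhds one_pos), self_mem_nhdsWithin] with r hr0 hr1
  have h := hu n r (real_mem_ball (le_of_lt hr0) hr1)
  rwa [← Complex.ofReal_pow, Complex.norm_real, Real.norm_of_nonneg (pow_nonneg (le_of_lt hr0) n)] at h

/-- … hence NO parameter-free majorant of the geometric family is summable: (E3) fails for it. [folklore] -/
theorem not_summable_of_majorant {u : ℕ → ℝ} (hu : ∀ n, ∀ s ∈ ball (0 : ℂ) 1, ‖s ^ n‖ ≤ u n) : ¬ Summable u := fun hs => by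
  have hev : ∀ᶠ n in atTop, u n < 1 := hs.tendsto_atTop_zero (Iio_mem_nhds one_pos)
  obtain ⟨n, hn⟩ := hev.exists
  exact absurd (one_le_of_majorant hu n) (not_le.mpr hn)

/-- The geometric output on the real segment `0 ≤ r < 1`: `‖Σ' n, r^n‖ = (1 − r)⁻¹`. [folklore] -/
theorem norm_tsum_geom_real {r : ℝ} (hr0 : 0 ≤ r) (hr1 : r < 1) : ‖∑' n : ℕ, (r : ℂ) ^ n‖ = (1 - r)⁻¹ := by
  have hn : ‖(r : ℂ)‖ < 1 := by rw [Complex.norm_real, Real.norm_of_nonneg hr0]; exact hr1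
  rw [(hasSum_geometric_of_norm_lt_one hn).tsum_eq, ← Complex.ofReal_one, ← Complex.ofReal_sub, ← Complex.ofReal_inv,
    Complex.norm_real, Real.norm_of_nonneg (inv_nonneg.mpr (by linarith))]

/-- **THE CONCLUSION OF `series_analytic_bounded` FAILS WITHOUT (E3)**: the geometric output `Σ' n, s^n = (1 − s)⁻¹` is NOT bounded on
the unit disc — so (E3) cannot be dropped from OUR module N0i §1 (a statement about its SHAPE, not about Bałaban's series). [folklore] -/
theorem not_bounded_geom : ¬ ∃ M : ℝ, ∀ s ∈ ball (0 : ℂ) 1, ‖∑' n : ℕ, s ^ n‖ ≤ M := by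
  rintro ⟨M, hM⟩
  obtain ⟨hM'1, hMM'⟩ : 1 ≤ max M 1 ∧ M ≤ max M 1 := ⟨le_max_right _ _, le_max_left _ _⟩
  have hq : 1 / (2 * max M 1) ≤ 1 / 2 := one_div_le_one_div_of_le (by norm_num) (by linarith)
  have hq0 : 0 < 1 / (2 * max M 1) := by positivity
  have hr0 : 0 ≤ 1 - 1 / (2 * max M 1) := by linarith
  have hr1 : 1 - 1 / (2 * max M 1) < 1 := by linarith
  have h := hM _ (real_mem_ball hr0 hr1)
  rw [norm_tsum_geom_real hr0 hr1, sub_sub_cancel, one_div, inv_inv] at h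
  linarith

/-! ## §5 One currency -/

/-- N0g's `regen_le_of_slack` applied to the CLOSED FORM `s ↦ cexp (b·s)` (entire; `‖cexp (b·s)‖ ≤ e^{b·ε/σ}` on the disc) returns
EXACTLY `regen_fires'`'s number: the termwise route (N0i) and the output route (N0g) agree on the datum. -/
example (hb : 0 ≤ b) (hσ : 0 < σ) (hσε : σ < ε) :
    ‖cexp ((b : ℂ) * 1) - cexp ((b : ℂ) * 0)‖ ≤ 2 * Real.exp (b * (ε / σ)) / ε * σ :=
  DressedSmallFieldAllowance.regen_le_of_slack (E := fun s => cexp ((b : ℂ) * s)) hσ hσε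
    (differentiable_id.const_mul (b : ℂ)).cexp.differentiableOn fun s hs => by
      rw [Complex.norm_exp, Complex.re_ofReal_mul]
      exact Real.exp_le_exp.2 (mul_le_mul_of_nonneg_left
        ((Complex.re_le_norm s).trans (mem_ball_zero_iff.1 hs).le) hb)

end Summit.QuantumFields.BalabanUV.T4Continuum.NE1p.DressedSmallFieldSeriesWitness

end
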